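import Summits.CriticalPhenomena.SAWScalingLimit.Theorems.SAWDefectDecoherenceObservableToSLERCarvedReductionSqueezeSuperDomainCuts
import Literature.Topology.PlaneTopology.ArcGluing
import HarnessLib

/-!
# Replacing a sub-arc of a cross-cut (piece (T-A′ frame-a) of stub T-A′
# `stub_carvedReduction_squeezeGeometry_domains`)

Crux `SAWDevelopingMap.ObservableToSLE` (stmt-CriticalPhenomena-10472), line `six-class-type-ladder`,
stub T-A′ `stub_carvedReduction_squeezeGeometry_domains` (the continuum geometry of the pinned
frame).  Landing target:
`Summits/CriticalPhenomena/SAWScalingLimit/Theorems/SAWDevelopingMapObservableToSLETypeLadderCarvedReductionSqueezeArcReplace.lean`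
(`--supports stmt-CriticalPhenomena-10472`; registered carrier `stub_carvedReduction_crosscutReplace`).

The window cross-cuts of the common super-domain are produced by the twin's
`Squeeze.stub_carvedReduction_legsToCrosscut` (p135598) for a LOWERED window and then corrected near
the gate: the lowered diameter is replaced by the three-sided frame hanging from the gate line
(sequel `…SqueezeWindowFrame`).  This file is the plane topology of that replacement:

* `subset_or_subset_of_notMem`, `exists_Icc_image_eq`, `endpoint_eq_or` — sub-arcs of an
  injective path: a preconnected subset of `γ[α, β]` missing `γ u` lies on one side of `u`; a
  closed connected subset of a simple arc is a sub-arc `γ[t₀, t₁]`; the endpoints of a sub-arc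
  are `γ t₀`, `γ t₁` (removing an inner point disconnects, removing an endpoint does not);
* `IsSimpleArc.replace`, `crosscut_replace` (= registered `stub_carvedReduction_crosscutReplace`)
  — replacing a sub-arc `S` (off the endpoints) of a simple arc / cross-cut `L` by a simple arc
  `F` with the same endpoints and `F ∩ L ⊆ S` (inside the domain) gives the simple arc /
  cross-cut `(L ∖ S) ∪ F`;
* `mem_hSegment_iff`, `mem_vSegment_iff` — coordinates on horizontal / vertical segments.

Sources: M. H. A. Newman, Elements of the topology of plane sets of points (1939), Ch. III §1
(sub-arcs, gluing), Ch. V §11 (cross-cuts).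
-/

noncomputable section
open scoped Topology
open Filter Set Metric
open Literature.Probability.RandomPlanarGeometry
open Literature.Topology.PlaneTopology

namespace Summit.CriticalPhenomena.SAWScalingLimit.Theorems.ObservableToSLE.TypeLadder

/-! ### Sub-arcs of an injective path -/

section SubArc

variable {γ : ℝ → ℂ}

/-- A preconnected subset of `γ[α, β]` missing the point `γ u`, `α ≤ u ≤ β`, lies in `γ[α, u]`
or in `γ[u, β]` (`γ` continuous and injective on `[0, 1] ⊇ [α, β]`). -/
theorem subset_or_subset_of_notMem (hγ : ContinuousOn γ (Icc 0 1)) (hinj : InjOn γ (Icc 0 1))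
    {α u β : ℝ} (hα : 0 ≤ α) (hαu : α ≤ u) (huβ : u ≤ β) (hβ : β ≤ 1) {C : Set ℂ}
    (hC : IsPreconnected C) (hCsub : C ⊆ γ '' Icc α β) (hu : γ u ∉ C) :
    C ⊆ γ '' Icc α u ∨ C ⊆ γ '' Icc u β := by
  have hA : IsClosed (γ '' Icc α u) :=
    (isCompact_Icc.image_of_continuousOn (hγ.mono (Icc_subset_Icc hα (huβ.trans hβ)))).isClosed
  have hB : IsClosed (γ '' Icc u β) :=
    (isCompact_Icc.image_of_continuousOn (hγ.mono (Icc_subset_Icc (hα.trans hαu) hβ))).isClosed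
  have hcover : C ⊆ γ '' Icc α u ∪ γ '' Icc u β := by
    intro z hz
    obtain ⟨t, ht, rfl⟩ := hCsub hz
    rcases le_total t u with h | h
    · exact Or.inl ⟨t, ⟨ht.1, h⟩, rfl⟩
    · exact Or.inr ⟨t, ⟨h, ht.2⟩, rfl⟩
  have hdisj : C ∩ (γ '' Icc α u ∩ γ '' Icc u β) = ∅ := by
    refine Set.eq_empty_iff_forall_notMem.2 ?_
    rintro z ⟨hzC, ⟨s, hs, hsz⟩, ⟨t, ht, htz⟩⟩
    have hst : s = t :=
      hinj ⟨hα.trans hs.1, hs.2.trans (huβ.trans hβ)⟩ ⟨(hα.trans hαu).trans ht.1, ht.2.trans hβ⟩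
        (hsz.trans htz.symm)
    have hsu : s = u := le_antisymm hs.2 (hst ▸ ht.1)
    exact hu (by rw [← hsu, hsz]; exact hzC)
  exact (isPreconnected_iff_subset_of_disjoint_closed.1 hC) _ _ hA hB hcover hdisj

/-- **A closed connected subset of a simple arc is a sub-arc**: its trace on `[0, 1]` is a closed
interval `[t₀, t₁]` with `γ[t₀, t₁] = S`. -/
theorem exists_Icc_image_eq (hγ : ContinuousOn γ (Icc 0 1)) (hinj : InjOn γ (Icc 0 1)) {S : Set ℂ}
    (hS : IsPreconnected S) (hScl : IsClosed S) (hSne : S.Nonempty) (hSL : S ⊆ γ '' Icc 0 1) :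
    ∃ t₀ t₁ : ℝ, 0 ≤ t₀ ∧ t₀ ≤ t₁ ∧ t₁ ≤ 1 ∧ γ '' Icc t₀ t₁ = S ∧
      ∀ t ∈ Icc (0 : ℝ) 1, γ t ∈ S → t₀ ≤ t ∧ t ≤ t₁ := by
  set T : Set ℝ := Icc 0 1 ∩ γ ⁻¹' S with hT
  have hTcl : IsClosed T := hγ.preimage_isClosed_of_isClosed isClosed_Icc hScl
  have hTne : T.Nonempty := by
    obtain ⟨z, hz⟩ := hSne
    obtain ⟨t, ht, rfl⟩ := hSL hz
    exact ⟨t, ht, hz⟩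
  have hTbdd : BddBelow T := ⟨0, fun t ht => ht.1.1⟩
  have hTbdd' : BddAbove T := ⟨1, fun t ht => ht.1.2⟩
  set t₀ : ℝ := sInf T with ht₀def
  set t₁ : ℝ := sSup T with ht₁def
  have ht₀ : t₀ ∈ T := hTcl.csInf_mem hTne hTbdd
  have ht₁ : t₁ ∈ T := hTcl.csSup_mem hTne hTbdd'
  have hle : ∀ t ∈ T, t₀ ≤ t ∧ t ≤ t₁ := fun t ht => ⟨csInf_le hTbdd ht, le_csSup hTbdd' ht⟩
  have h01 : t₀ ≤ t₁ := (hle t₁ ht₁).1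
  have hSL' : S ⊆ γ '' Icc 0 1 := hSL
  have hfill : ∀ u, t₀ ≤ u → u ≤ t₁ → γ u ∈ S := by
    intro u h0u hu1
    by_contra hu
    rcases subset_or_subset_of_notMem hγ hinj le_rfl (ht₀.1.1.trans h0u) (hu1.trans ht₁.1.2) le_rfl
        hS hSL' hu with h | h
    · obtain ⟨s, hs, hst⟩ := h ht₁.2
      have hst₁ : s = t₁ := hinj ⟨hs.1, hs.2.trans (hu1.trans ht₁.1.2)⟩ ht₁.1 hst
      have hut : u = t₁ := le_antisymm hu1 (hst₁ ▸ hs.2)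
      exact hu (hut ▸ ht₁.2)
    · obtain ⟨s, hs, hst⟩ := h ht₀.2
      have hst₀ : s = t₀ := hinj ⟨(ht₀.1.1.trans h0u).trans hs.1, hs.2⟩ ht₀.1 hst
      have hut : u = t₀ := le_antisymm (hst₀ ▸ hs.1) h0u
      exact hu (hut ▸ ht₀.2)
  refine ⟨t₀, t₁, ht₀.1.1, h01, ht₁.1.2, ?_, fun t ht htS => hle t ⟨ht, htS⟩⟩
  apply Subset.antisymm
  · rintro _ ⟨u, hu, rfl⟩
    exact hfill u hu.1 hu.2
  · intro z hz
    obtain ⟨t, ht, rfl⟩ := hSL hz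
    exact ⟨t, hle t ⟨ht, hz⟩, rfl⟩

/-- **Endpoints are endpoints**: if the sub-arc `γ[t₀, t₁]` is a simple arc from `p` to `q`, then
`p` is `γ t₀` or `γ t₁` (removing an inner point disconnects, removing `p` does not). -/
theorem endpoint_eq_or (hγ : ContinuousOn γ (Icc 0 1)) (hinj : InjOn γ (Icc 0 1)) {t₀ t₁ : ℝ}
    (h0 : 0 ≤ t₀) (h01 : t₀ ≤ t₁) (h1 : t₁ ≤ 1) {S : Set ℂ} {p q : ℂ} (hS : IsSimpleArc S p q)
    (hSeq : γ '' Icc t₀ t₁ = S) : p = γ t₀ ∨ p = γ t₁ := by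
  have hpS : p ∈ S := hS.left_mem
  obtain ⟨σ, hσ, hσinj, hσS, hσ0, hσ1⟩ := hS
  have hpS' : p ∈ γ '' Icc t₀ t₁ := by rwa [hSeq]
  obtain ⟨u, hu, hup⟩ := hpS'
  by_contra hne
  push Not at hne
  have hut₀ : t₀ < u := lt_of_le_of_ne hu.1 fun h => hne.1 (by rw [← hup, h])
  have hut₁ : u < t₁ := lt_of_le_of_ne hu.2 fun h => hne.2 (by rw [← hup, h])
  -- `S ∖ {p} = σ (0, 1]` is preconnected
  have hC : IsPreconnected (S \ {p}) := by
    have heq : S \ {p} = σ '' Ioc 0 1 := by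
      ext z
      constructor
      · rintro ⟨hz, hzp⟩
        rw [← hσS] at hz
        obtain ⟨s, hs, rfl⟩ := hz
        refine ⟨s, ⟨lt_of_le_of_ne hs.1 ?_, hs.2⟩, rfl⟩
        rintro rfl
        exact hzp (by rw [hσ0]; exact rfl)
      · rintro ⟨s, hs, rfl⟩
        refine ⟨hσS ▸ ⟨s, ⟨hs.1.le, hs.2⟩, rfl⟩, fun h => ?_⟩
        have h' : σ s = σ 0 := by rw [hσ0]; exact h
        have := hσinj ⟨hs.1.le, hs.2⟩ ⟨le_rfl, zero_le_one⟩ h'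
        exact hs.1.ne' this
    rw [heq]
    exact isPreconnected_Ioc.image σ (hσ.mono Ioc_subset_Icc_self)
  have hCsub : S \ {p} ⊆ γ '' Icc t₀ t₁ := fun z hz => by rw [hSeq]; exact hz.1
  have hpC : γ u ∉ S \ {p} := fun h => h.2 hup
  rcases subset_or_subset_of_notMem hγ hinj h0 hu.1 hu.2 h1 hC hCsub hpC with h | h
  · have ht₁C : γ t₁ ∈ S \ {p} :=
      ⟨by rw [← hSeq]; exact ⟨t₁, ⟨h01, le_rfl⟩, rfl⟩, fun h' => hne.2 (Eq.symm h')⟩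
    obtain ⟨s, hs, hst⟩ := h ht₁C
    have hs₁ : s = t₁ := hinj ⟨h0.trans hs.1, hs.2.trans (hu.2.trans h1)⟩ ⟨h0.trans h01, h1⟩ hst
    rw [hs₁] at hs
    exact absurd hs.2 (not_le.2 hut₁)
  · have ht₀C : γ t₀ ∈ S \ {p} :=
      ⟨by rw [← hSeq]; exact ⟨t₀, ⟨le_rfl, h01⟩, rfl⟩, fun h' => hne.1 (Eq.symm h')⟩
    obtain ⟨s, hs, hst⟩ := h ht₀C
    have hs₀ : s = t₀ := hinj ⟨(h0.trans hu.1).trans hs.1, hs.2.trans h1⟩ ⟨h0, h01.trans h1⟩ hst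
    rw [hs₀] at hs
    exact absurd hs.1 (not_le.2 hut₀)

end SubArc

/-! ### Replacing a sub-arc -/

/-- **Replacing a sub-arc.**  Let `L` be a simple arc from `a` to `b`, `S ⊆ L` a simple arc from
`p` to `q` off `a`, `b`, and `F` a simple arc from `p` to `q` with `F ∩ L ⊆ S`.  Then
`(L ∖ S) ∪ F` is a simple arc from `a` to `b`. [cite: Newman1939, Ch. III §1] -/
theorem _root_.Literature.Topology.PlaneTopology.IsSimpleArc.replace {L S F : Set ℂ} {a b p q : ℂ}
    (hL : IsSimpleArc L a b) (hS : IsSimpleArc S p q) (hSL : S ⊆ L) (ha : a ∉ S) (hb : b ∉ S)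
    (hF : IsSimpleArc F p q) (hFL : F ∩ L ⊆ S) : IsSimpleArc ((L \ S) ∪ F) a b := by
  obtain ⟨γ, hγ, hinj, hγL, hγ0, hγ1⟩ := hL
  obtain ⟨t₀, t₁, h0, h01, h1, hSeq, hT⟩ :=
    exists_Icc_image_eq hγ hinj hS.isConnected.isPreconnected hS.isCompact.isClosed
      ⟨p, hS.left_mem⟩ (hγL.symm ▸ hSL)
  -- `0 < t₀`, `t₁ < 1`, `t₀ < t₁`
  have ht₀ : 0 < t₀ := by
    refine lt_of_le_of_ne h0 fun h => ha ?_
    rw [← hγ0, h, ← hSeq]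
    exact ⟨t₀, ⟨le_rfl, h01⟩, rfl⟩
  have ht₁ : t₁ < 1 := by
    refine lt_of_le_of_ne h1 fun h => hb ?_
    rw [← hγ1, ← h, ← hSeq]
    exact ⟨t₁, ⟨h01, le_rfl⟩, rfl⟩
  have ht₀₁ : t₀ < t₁ := by
    refine lt_of_le_of_ne h01 fun h => hS.ne ?_
    have hsing : S = {γ t₀} := by rw [← hSeq, ← h, Icc_self, image_singleton]
    have hp : p ∈ S := hS.left_mem
    have hq : q ∈ S := hS.right_mem
    rw [hsing] at hp hq
    rw [mem_singleton_iff.1 hp, mem_singleton_iff.1 hq]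
  -- the two remaining pieces
  set L₁ : Set ℂ := γ '' Icc 0 t₀ with hL₁
  set L₂ : Set ℂ := γ '' Icc t₁ 1 with hL₂
  have hL₁arc : IsSimpleArc L₁ a (γ t₀) := by
    have := isSimpleArc_image_Icc hγ hinj le_rfl ht₀ (h01.trans h1)
    rwa [hγ0] at this
  have hL₂arc : IsSimpleArc L₂ (γ t₁) b := by
    have := isSimpleArc_image_Icc hγ hinj (h0.trans h01) ht₁ le_rfl
    rwa [hγ1] at this
  -- `F` reoriented from `γ t₀` to `γ t₁`
  have hends : (p = γ t₀ ∧ q = γ t₁) ∨ (p = γ t₁ ∧ q = γ t₀) := by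
    have hp := endpoint_eq_or hγ hinj h0 h01 h1 hS hSeq
    have hq := endpoint_eq_or hγ hinj h0 h01 h1 hS.symm hSeq
    have hpq : p ≠ q := hS.ne
    have h01ne : γ t₀ ≠ γ t₁ := fun h =>
      ht₀₁.ne (hinj ⟨h0, h01.trans h1⟩ ⟨h0.trans h01, h1⟩ h)
    rcases hp with hp | hp <;> rcases hq with hq | hq
    · exact absurd (hp.trans hq.symm) hpq
    · exact Or.inl ⟨hp, hq⟩
    · exact Or.inr ⟨hp, hq⟩
    · exact absurd (hp.trans hq.symm) hpq
  have hF' : IsSimpleArc F (γ t₀) (γ t₁) := by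
    rcases hends with ⟨rfl, rfl⟩ | ⟨rfl, rfl⟩
    · exact hF
    · exact hF.symm
  have hFS₀ : γ t₀ ∈ F := hF'.left_mem
  have hFS₁ : γ t₁ ∈ F := hF'.right_mem
  -- points of `F ∩ L` have parameters in `[t₀, t₁]`
  have hFpar : ∀ s ∈ Icc (0 : ℝ) 1, γ s ∈ F → t₀ ≤ s ∧ s ≤ t₁ := fun s hs hsF =>
    hT s hs (hFL ⟨hsF, hγL ▸ ⟨s, hs, rfl⟩⟩)
  -- gluing
  have hglue₁ : IsSimpleArc (L₁ ∪ F) a (γ t₁) := by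
    refine hL₁arc.union hF' ?_
    rintro z ⟨⟨s, hs, rfl⟩, hzF⟩
    have := (hFpar s ⟨hs.1, hs.2.trans (h01.trans h1)⟩ hzF).1
    rw [show s = t₀ from le_antisymm hs.2 this]
    rfl
  have hglue₂ : IsSimpleArc (L₁ ∪ F ∪ L₂) a b := by
    refine hglue₁.union hL₂arc ?_
    rintro z ⟨hz, ⟨s, hs, rfl⟩⟩
    rcases hz with ⟨s', hs', hss'⟩ | hzF
    · exfalso
      have : s' = s := hinj ⟨hs'.1, hs'.2.trans (h01.trans h1)⟩ ⟨(h0.trans h01).trans hs.1, hs.2⟩ hss'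
      rw [this] at hs'
      exact absurd (hs'.2.trans_lt ht₀₁) (not_lt.2 hs.1)
    · have := (hFpar s ⟨(h0.trans h01).trans hs.1, hs.2⟩ hzF).2
      rw [show s = t₁ from le_antisymm this hs.1]
      rfl
  -- the glued set is `(L ∖ S) ∪ F`
  have heq : L \ S ∪ F = L₁ ∪ F ∪ L₂ := by
    apply Subset.antisymm
    · rintro z (⟨hzL, hzS⟩ | hzF)
      · rw [← hγL] at hzL
        obtain ⟨s, hs, rfl⟩ := hzL
        have hs' : s < t₀ ∨ t₁ < s := by
          by_contra hcon
          push Not at hcon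
          exact hzS (hSeq ▸ ⟨s, ⟨hcon.1, hcon.2⟩, rfl⟩)
        rcases hs' with hs' | hs'
        · exact Or.inl (Or.inl ⟨s, ⟨hs.1, hs'.le⟩, rfl⟩)
        · exact Or.inr ⟨s, ⟨hs'.le, hs.2⟩, rfl⟩
      · exact Or.inl (Or.inr hzF)
    · rintro z ((⟨s, hs, rfl⟩ | hzF) | ⟨s, hs, rfl⟩)
      · rcases hs.2.lt_or_eq with hlt | heq
        · refine Or.inl ⟨hγL ▸ ⟨s, ⟨hs.1, hs.2.trans (h01.trans h1)⟩, rfl⟩, fun hzS => ?_⟩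
          have := (hT s ⟨hs.1, hs.2.trans (h01.trans h1)⟩ hzS).1
          exact absurd hlt (not_lt.2 this)
        · exact Or.inr (heq ▸ hFS₀)
      · exact Or.inr hzF
      · rcases hs.1.lt_or_eq with hlt | heq
        · refine Or.inl ⟨hγL ▸ ⟨s, ⟨(h0.trans h01).trans hs.1, hs.2⟩, rfl⟩, fun hzS => ?_⟩
          have := (hT s ⟨(h0.trans h01).trans hs.1, hs.2⟩ hzS).2
          exact absurd hlt (not_lt.2 this)
        · exact Or.inr (heq ▸ hFS₁)
  rw [heq]
  exact hglue₂

/-- **Replacing a sub-arc of a cross-cut** by a simple arc inside the domain with the same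
endpoints gives a cross-cut with the same endpoints. [cite: Newman1939, Ch. V §11] -/
theorem crosscut_replace (J : JordanDomain) {L S F : Set ℂ} {a b p q : ℂ}
    (hL : J.IsCrosscut L a b) (hS : IsSimpleArc S p q) (hSL : S ⊆ L) (ha : a ∉ S) (hb : b ∉ S)
    (hF : IsSimpleArc F p q) (hFL : F ∩ L ⊆ S) (hFJ : F ⊆ J.carrier) :
    J.IsCrosscut ((L \ S) ∪ F) a b := by
  obtain ⟨hLarc, haJ, hbJ, hab, hLJ⟩ := hL
  refine ⟨hLarc.replace hS hSL ha hb hF hFL, haJ, hbJ, hab, ?_⟩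
  rintro z ⟨hz | hz, hzab⟩
  · exact hLJ ⟨hz.1, hzab⟩
  · exact hFJ hz


/-- **Registered carrier `stub_carvedReduction_crosscutReplace`** (crux item
stmt-CriticalPhenomena-10472, stub T-A′ `stub_carvedReduction_squeezeGeometry_domains`, piece
SUB-ARC REPLACEMENT): `crosscut_replace`, quantified. -/
theorem stub_carvedReduction_crosscutReplace :
    ∀ (J : JordanDomain) (L S F : Set ℂ) (a b p q : ℂ), J.IsCrosscut L a b →
      Literature.Topology.PlaneTopology.IsSimpleArc S p q → S ⊆ L → a ∉ S → b ∉ S →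
      Literature.Topology.PlaneTopology.IsSimpleArc F p q → F ∩ L ⊆ S → F ⊆ J.carrier →
      J.IsCrosscut ((L \ S) ∪ F) a b :=
  fun J _ _ _ _ _ _ _ hL hS hSL ha hb hF hFL hFJ => crosscut_replace J hL hS hSL ha hb hF hFL hFJ

/-! ### Horizontal and vertical segments -/

/-- Points of the horizontal segment `[g - r, g + r]` (`0 < r`): height `im g`, abscissa within
`r` of `re g`. -/
theorem mem_hSegment_iff {g z : ℂ} {r : ℝ} (hr : 0 < r) :
    z ∈ segment ℝ (g - r) (g + r) ↔ z.im = g.im ∧ |z.re - g.re| ≤ r := by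
  rw [segment_eq_image']
  constructor
  · rintro ⟨θ, hθ, rfl⟩
    refine ⟨by simp, ?_⟩
    have hre : (g - r + θ • (g + r - (g - r))).re - g.re = (2 * θ - 1) * r := by
      simp; ring
    rw [hre, abs_le]
    constructor <;> nlinarith [hθ.1, hθ.2]
  · rintro ⟨him, hre⟩
    obtain ⟨h1, h2⟩ := abs_le.1 hre
    set θ : ℝ := (z.re - g.re + r) / (2 * r) with hθ
    refine ⟨θ, ⟨div_nonneg (by linarith) (by linarith), (div_le_one (by linarith)).2 (by linarith)⟩, ?_⟩
    have hsm : θ • (g + ↑r - (g - ↑r)) = ((θ * (2 * r) : ℝ) : ℂ) := by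
      rw [Complex.real_smul]; push_cast; ring
    have hθr : θ * (2 * r) = z.re - g.re + r := by
      rw [hθ]; field_simp
    show g - ↑r + θ • (g + ↑r - (g - ↑r)) = z
    rw [hsm, hθr]
    apply Complex.ext
    · simp only [Complex.add_re, Complex.sub_re, Complex.ofReal_re]; ring
    · simp only [Complex.add_im, Complex.sub_im, Complex.ofReal_im]; rw [him]; ring

/-- Points of the vertical segment `[c, c - h i]` (`0 < h`): abscissa `re c`, height in
`[im c - h, im c]`. -/
theorem mem_vSegment_iff {c z : ℂ} {h : ℝ} (hh : 0 < h) :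
    z ∈ segment ℝ c (c - h * Complex.I) ↔ z.re = c.re ∧ c.im - h ≤ z.im ∧ z.im ≤ c.im := by
  rw [segment_eq_image']
  constructor
  · rintro ⟨θ, hθ, rfl⟩
    refine ⟨by simp, ?_, ?_⟩
    · simp; nlinarith [hθ.2]
    · simp; nlinarith [hθ.1]
  · rintro ⟨hre, h1, h2⟩
    refine ⟨(c.im - z.im) / h, ⟨div_nonneg (by linarith) hh.le, (div_le_one hh).2 (by linarith)⟩, ?_⟩
    apply Complex.ext
    · simp [hre]
    · simp; field_simp; ring

end Summit.CriticalPhenomena.SAWScalingLimit.Theorems.ObservableToSLE.TypeLadder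

end
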